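import Summits.QuantumFields.BalabanUV.Beta.GAN24.FaceWeightedSandwich
import Summits.QuantumFields.BalabanUV.Beta.GAN24.HessianGaugeLegContact
import Summits.QuantumFields.BalabanUV.Beta.GAN24.ContactFaceJump
import Summits.QuantumFields.BalabanUV.Beta.GAN24.PiBmConstants
import Summits.QuantumFields.BalabanUV.Beta.GAN24.KernelLegCharges
import Literature.MathematicalPhysics.QuantumFieldTheory.Balaban1983to89.Beta.OneStepKernelFamily
import Literature.MathematicalPhysics.QuantumFieldTheory.Balaban1983to89.Beta.BalabanStepJetsSucc

/-!
# `BalabanUV.Beta.GAN24.LambdaPieceThreeFace` — binder row G-an2-4 ∕ (CONV-C), W-slot CT-W, route «WC-TL», table fact «3F-REC» ∕ «S3C-REC» (PRICING Q-S3C):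
# **THE Λ-PIECE FACE LETTER (T-H)_face IS A THEOREM** — the three-face-legs cell form (exit faces of every period `Lc^{k+1}`) of the Λ-piece
# `SLam Lc c hessFFAt` vanishes AT EVERY SLOT, for every admissible coefficient family `c` — in particular for Bałaban's `lamCoeffK (KInvStep Lc (j+1)) (E2 d Lc (j+1)) Lc`
# (every level, the hypothesis `hΛ` of `ThreeFaceRecOfLetters`) and `lamCoeffOf (KInv Lc) Lc` (level 0)

NOT IN PRINT; OUR BOOKKEEPING ([folklore] bookkeeping BY NAME over leaf-02 g47's `HessianGaugeLegContact.tsum_dz_mul_SLam_hessFFAt` (the `dψ`-law of the Λ-piece,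
EVERY `ψ`, EVERY `c`), leaf-02's `ContactFaceJump.linKerAt_eq_zero_of_not_twoBlock` ∕ `blk_root` ∕ `blk_farRoot` (support of an1's rooted first-order kernel), an2's
`PiBmConstants.int_succ_ediv`; the mechanism is leaf-02 g55's R-leaf02-g55-3 («the exit-face form IS EXACT»), here for the UNSYMMETRISED `hessFFAt` with
super-block periods; G-an2-4 formalisation swarm, leaf prover `b2b-balaban-gan24-formalise-leaf-04`, gen 62).  HONEST FRAMING (cell contract, verbatim): «discharging
`BetaPertH` makes Bałaban's UV stability UNCONDITIONAL — a real constructive-QFT result; it is NOT the continuum limit and NOT the Clay problem.»  HONEST DEPENDENCY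
(verbatim): «continuum YM on T⁴ ⇐ BetaPertH ∧ nine spine estimates (0/9 proved); BetaPertH ⇐ (D1) ∧ (D4) ∧ CAP+tail; G-an2-4 gates asym, D1 and NE2/3/4.»

MECHANISM.  The first-leg weight `[κ = α]·[x_α % P = P−1]` (`P = Lc^{k+1}`) is the GRADIENT of the coarse coordinate `ψ_α x = ⌊x_α ∕ P⌋` (`dz_coarseCoord`), so
leaf-02's `dψ`-law turns the first face leg into `−Σ_μ Σ'_y c μ y κ′ u · W_{(μ,y)}(x′) · q¹_{(μ,y)}(β, x′) ∕ 2`, `W = ψ_α x′ + ψ_α (x′ + e_β) − ψ_α r − ψ_α (r + Lc•e_μ)`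
(`r = Lc•y + ρ` the root).  The second-leg weight `[x′_β % P = P−1]` kills EVERY term (`face_coordW_linKerAt_eq_zero`): a bond on a period-`P` exit face sits on an
exit face of an `Lc`-block (`FaceWeightedSandwich.emod_mul_eq_iff`), so its two endpoints have `β`-block labels differing by one (`int_succ_ediv`); the rooted
first-order kernel lives on bonds whose endpoints both have block label `y` or `y + e_μ` (`linKerAt_eq_zero_of_not_twoBlock`) — impossible for `β ≠ μ`, and for
`β = μ` it forces the labels `y_μ`, `y_μ + 1`, which are also the labels of the root and the far root (`blk_root`, `blk_farRoot`), so the four coarse coordinates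
`⌊label_α ∕ Lc^k⌋` (`ediv_pow_succ_eq_blk`) cancel in pairs (for `α ≠ μ` all four agree).  The pair sum is then zero slot by slot (Fubini on the bi-localised pair
family, `summable_weighted_pairs`), and so is the slot-face sum.

WHAT ([folklore]; 0 `def`, 0 cited facts, 0 `def … : Prop`, 0 sorry; generic `d`, `Lc ≥ 1`, box root, every `k`): §1 `ediv_pow_succ_eq_blk`, `dz_coarseCoord`; §2
**`face_coordW_linKerAt_eq_zero`**; §3 `tsum_face_mul_SLam_hessFFAt`, **`face_mul_tsum_face_mul_SLam_hessFFAt`**; §4 `summable_weighted_pairs`,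
**`tsum_faces_SLam_hessFFAt_eq_zero`** (every slot), **`threeFace_SLam_hessFFAt_eq_zero`** (any `c` with `LocStencil (SLam Lc c hessFFAt) C δ`, `δ > 0`); §5
**`threeFace_SLam_lamCoeffK_eq_zero`** (every level `j+1`: EXACTLY the hypothesis `hΛ` of `ThreeFaceRecOfLetters.threeFace_rec_of_letters`),
**`threeFace_SLam_lamCoeffOf_eq_zero`** (level 0).  CONSEQUENCE (with this lineage's chain PART 1∕2 + A–F): «3F-REC», «S3C-REC» (every member) and the D1
literal's table input reduce to ONE finite letter, the cubic-Wilson face law (T-W)_face at periods `Lc^{k+1}` (⟸ four offset-graded colour-block sums over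
`WilsonIdx`, exact at D = 2,3,4).  Asserts NO value of Bałaban's tables beyond these identities; discharges NOTHING of (T-W)_face ∕ (C)sym ∕ (Q-D) ∕ (Q-D-rate) ∕
«T2Shape» ∕ «T2Drift» ∕ (hW, hWall); NOT «D1 closed»; NEVER «G-an2-4 closed» as (CONV-C); NOT D1, NOT `BetaPertH`, NOT continuum, NOT Clay.  2026-08-22; no existing
file touched.
-/

noncomputable section

open Finset
open scoped BigOperators
open Literature.MathematicalPhysics.QuantumFieldTheory
open Literature.MathematicalPhysics.QuantumFieldTheory.Balaban1983to89
open Literature.MathematicalPhysics.QuantumFieldTheory.Balaban1983to89.Beta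
open B12Sec2to5 (l1)
open ExpKernelCalculus (Site MKer BiLoc Decays VertexFamily Zl Zl_nonneg)
open AffineAveraging (Form0 Form1 box toSite unitVec unitVec_apply dz)
open AveragingContours (blk)
open AveragingHessianKernels (Bond ell)
open AveragingHessianKernelsRooted (linCountAt linKerAt hessFFAt biLoc_hessFFAt)
open OneStepResolventKernel (Fib KInv LocStencil decays_KInv decays_mono)
open OneStepKernelFamily (KInvStep decays_KInvStep)
open BalabanStepJets (lamCoeffOf abs_lamCoeffOf_le)
open BalabanStepJetsSucc (E2 decays_E2 lamCoeffK abs_lamCoeffK_le)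
open InterLevelTransport (SLam locStencil_SLam)

namespace Summit.QuantumFields.BalabanUV.Beta.GAN24.LambdaPieceThreeFace

open Summit.QuantumFields.BalabanUV.Beta.GAN24.FaceWeightedSandwich (emod_mul_eq_iff)
open Summit.QuantumFields.BalabanUV.Beta.GAN24.ContactFaceJump (linKerAt_eq_zero_of_not_twoBlock blk_root blk_farRoot)
open Summit.QuantumFields.BalabanUV.Beta.GAN24.PiBmConstants (int_succ_ediv)
open Summit.QuantumFields.BalabanUV.Beta.GAN24.HessianGaugeLegContact (tsum_dz_mul_SLam_hessFFAt)

variable {d : ℕ} {Lc : ℕ}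

/-! ## §1 The coarse coordinate `ψ_α^{(k)} z := ⌊z_α ∕ Lc^{k+1}⌋` and its gradient, the period-`Lc^{k+1}` exit-face form -/

/-- [folklore] `⌊z_α ∕ Lc^{k+1}⌋ = ⌊(blk Lc z)_α ∕ Lc^k⌋`. -/
theorem ediv_pow_succ_eq_blk (Lc : ℕ) (k : ℕ) (z : Site (d + 1)) (α : Fin (d + 1)) :
    z α / ((Lc ^ (k + 1) : ℕ) : ℤ) = blk Lc z α / ((Lc ^ k : ℕ) : ℤ) := by
  have hL : (0 : ℤ) ≤ (Lc : ℤ) := by exact_mod_cast (Nat.zero_le Lc)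
  simp only [blk]
  rw [show ((Lc ^ (k + 1) : ℕ) : ℤ) = (Lc : ℤ) * ((Lc ^ k : ℕ) : ℤ) by push_cast; ring]
  exact (Int.ediv_ediv_of_nonneg hL).symm

/-- [folklore] **THE EXIT-FACE FORM IS EXACT**: `dz ⌊·_α ∕ P⌋ (κ, x) = [κ = α]·[x_α % P = P − 1]` (`P = Lc^{k+1} ≥ 1`). -/
theorem dz_coarseCoord (hLc : 1 ≤ Lc) (k : ℕ) (α κ : Fin (d + 1)) (x : Site (d + 1)) :
    dz (fun z : Site (d + 1) => ((z α / ((Lc ^ (k + 1) : ℕ) : ℤ) : ℤ) : ℝ)) κ x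
      = (if κ = α then (1 : ℝ) else 0) * (if x α % ((Lc ^ (k + 1) : ℕ) : ℤ) = ((Lc ^ (k + 1) : ℕ) : ℤ) - 1 then (1 : ℝ) else 0) := by
  have hP : (0 : ℤ) < ((Lc ^ (k + 1) : ℕ) : ℤ) := by exact_mod_cast pow_pos (by omega) _
  simp only [dz, Pi.add_apply, unitVec_apply]
  by_cases hκ : κ = α
  · subst hκ
    simp only [if_true, one_mul]
    rw [int_succ_ediv hP]
    push_cast
    split_ifs <;> simp
  · have : (if α = κ then (1 : ℤ) else 0) = 0 := if_neg (Ne.symm hκ)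
    rw [this, add_zero, sub_self, if_neg hκ, zero_mul]

/-! ## §2 The support lemma: on a period-`Lc^{k+1}` exit-face bond carrying the first-order kernel, the coordinate weight vanishes -/

section Support

variable {r : Fin (d + 1) → ℕ}

/-- NOT IN PRINT; OUR BOOKKEEPING.  **THE KEY SUPPORT LEMMA**: for the box root, every coarse bond `(μ, y)`, every fine bond `(β, x′)` on a period-`Lc^{k+1}`
exit face (`x′_β % Lc^{k+1} = Lc^{k+1} − 1`) and every direction `α`:
`[x′_β face] · (ψ x′ + ψ (x′ + e_β) − ψ r_{(μ,y)} − ψ (r_{(μ,y)} + Lc•e_μ)) · q¹_{(μ,y)}(β, x′) = 0`, `ψ z = ⌊z_α ∕ Lc^{k+1}⌋`, `r_{(μ,y)} = Lc•y + ρ` —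
transverse contour bonds never sit on an exit face of an `Lc`-block (`ContactFaceJump.linKerAt_eq_zero_of_not_twoBlock`), and on the one straight
exit bond the four coarse coordinates pair off (`blk_root`, `blk_farRoot`). -/
theorem face_coordW_linKerAt_eq_zero (hLc : 1 ≤ Lc) (hr : r ∈ box (d + 1) Lc) (k : ℕ) (μ : Fin (d + 1)) (y : Site (d + 1))
    (α β : Fin (d + 1)) (x' : Site (d + 1)) :
    (if x' β % ((Lc ^ (k + 1) : ℕ) : ℤ) = ((Lc ^ (k + 1) : ℕ) : ℤ) - 1 then (1 : ℝ) else 0) *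
      (((((x') α / ((Lc ^ (k + 1) : ℕ) : ℤ) : ℤ) : ℝ) + (((x' + unitVec β) α / ((Lc ^ (k + 1) : ℕ) : ℤ) : ℤ) : ℝ) - ((((Lc : ℤ) • y + toSite r) α / ((Lc ^ (k + 1) : ℕ) : ℤ) : ℤ) : ℝ) - ((((Lc : ℤ) • y + toSite r + (Lc : ℤ) • unitVec μ) α / ((Lc ^ (k + 1) : ℕ) : ℤ) : ℤ) : ℝ)) * linKerAt (toSite r) Lc μ y (β, x')) = 0 := by
  by_cases hF : x' β % ((Lc ^ (k + 1) : ℕ) : ℤ) = ((Lc ^ (k + 1) : ℕ) : ℤ) - 1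
  swap
  · rw [if_neg hF, zero_mul]
  rw [if_pos hF, one_mul]
  by_cases htwo : (blk Lc x' = y ∨ blk Lc x' = y + unitVec μ) ∧ (blk Lc (x' + unitVec β) = y ∨ blk Lc (x' + unitVec β) = y + unitVec μ)
  swap
  · rw [linKerAt_eq_zero_of_not_twoBlock hLc hr (f := (β, x')) htwo, mul_zero]
  -- on the support: the bond crosses an `Lc`-face in direction `β`
  have hLc0 : (0 : ℤ) < (Lc : ℤ) := by exact_mod_cast hLc
  have hPk : (0 : ℤ) < ((Lc ^ k : ℕ) : ℤ) := by exact_mod_cast pow_pos (by omega) _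
  have hF' : x' β % (Lc : ℤ) = (Lc : ℤ) - 1 := by
    have e : ((Lc ^ (k + 1) : ℕ) : ℤ) = (Lc : ℤ) * ((Lc ^ k : ℕ) : ℤ) := by push_cast; ring
    rw [e] at hF
    exact ((emod_mul_eq_iff hLc0 hPk (x' β)).1 hF).1
  have hstep : blk Lc (x' + unitVec β) β = blk Lc x' β + 1 := by
    simp only [blk, Pi.add_apply, unitVec_apply, if_true]
    rw [int_succ_ediv hLc0, if_pos hF']
  obtain ⟨h1, h2⟩ := htwo
  by_cases hβ : β = μ
  · -- the straight exit bond: the four coarse coordinates pair off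
    subst hβ
    have hb1 : blk Lc x' β = y β := by
      rcases h1 with h | h
      · rw [h]
      · exfalso
        have e2 : blk Lc (x' + unitVec β) β = y β + 2 := by rw [hstep, h]; simp [unitVec_apply]; ring
        rcases h2 with h' | h'
        · rw [h'] at e2; linarith
        · rw [h'] at e2; simp [unitVec_apply] at e2
    have hb2 : blk Lc (x' + unitVec β) β = y β + 1 := by rw [hstep, hb1]
    -- rewrite all four ψ-values through block labels
    rw [ediv_pow_succ_eq_blk Lc k x', ediv_pow_succ_eq_blk Lc k (x' + unitVec β), ediv_pow_succ_eq_blk Lc k ((Lc : ℤ) • y + toSite r),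
      ediv_pow_succ_eq_blk Lc k ((Lc : ℤ) • y + toSite r + (Lc : ℤ) • unitVec β), blk_root y hr, blk_farRoot y β hr]
    by_cases hα : α = β
    · subst hα
      rw [hb1, hb2]
      simp [unitVec_apply]
    · -- all four α-labels agree
      have e1 : blk Lc x' α = y α := by
        rcases h1 with h | h
        · rw [h]
        · rw [h]; simp [unitVec_apply, hα]
      have e2 : blk Lc (x' + unitVec β) α = y α := by
        rcases h2 with h | h
        · rw [h]
        · rw [h]; simp [unitVec_apply, hα]
      rw [e1, e2]
      simp [unitVec_apply, hα]
  · -- a transverse bond on an exit face carries no first-order kernel: contradiction with the two-block support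
    exfalso
    have e1 : blk Lc x' β = y β := by
      rcases h1 with h | h
      · rw [h]
      · rw [h]; simp [unitVec_apply, hβ]
    have e2 : blk Lc (x' + unitVec β) β = y β := by
      rcases h2 with h | h
      · rw [h]
      · rw [h]; simp [unitVec_apply, hβ]
    rw [hstep, e1] at e2
    linarith

end Support


/-! ## §3 The first face leg through leaf-02's `dψ`-law; the second face leg kills every term -/

section Legs

variable {r : Fin (d + 1) → ℕ} [NeZero Lc]

/-- NOT IN PRINT; OUR BOOKKEEPING.  **THE FIRST FACE LEG OF THE Λ-PIECE** (any coefficient family `c`): leaf-02's `tsum_dz_mul_SLam_hessFFAt` with `ψ = ⌊·_α ∕ Lc^{k+1}⌋`,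
whose gradient is the exit-face form (`dz_coarseCoord`). -/
theorem tsum_face_mul_SLam_hessFFAt (hLc : 1 ≤ Lc) (hr : r ∈ box (d + 1) Lc)
    (c : Fin (d + 1) → (Fin (d + 1) → ℤ) → Fin (d + 1) → (Fin (d + 1) → ℤ) → ℝ) (κ' : Fin (d + 1)) (u x' : Site (d + 1)) (α β : Fin (d + 1)) (k : ℕ) :
    ∑' x : Site (d + 1), (if x α % ((Lc ^ (k + 1) : ℕ) : ℤ) = ((Lc ^ (k + 1) : ℕ) : ℤ) - 1 then (1 : ℝ) else 0) *
        SLam Lc c (fun μ y => hessFFAt (toSite r) Lc μ y) κ' u x x' (Sum.inl α) (Sum.inl β)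
      = -∑ μ, ∑' y, c μ y κ' u *
          (((((x') α / ((Lc ^ (k + 1) : ℕ) : ℤ) : ℤ) : ℝ) + (((x' + unitVec β) α / ((Lc ^ (k + 1) : ℕ) : ℤ) : ℤ) : ℝ) - ((((Lc : ℤ) • y + toSite r) α / ((Lc ^ (k + 1) : ℕ) : ℤ) : ℤ) : ℝ) - ((((Lc : ℤ) • y + toSite r + (Lc : ℤ) • unitVec μ) α / ((Lc ^ (k + 1) : ℕ) : ℤ) : ℤ) : ℝ)) * linKerAt (toSite r) Lc μ y (β, x') / 2) := by
  have h := tsum_dz_mul_SLam_hessFFAt (N := Lc) hLc hr c κ' u x' β (fun z : Site (d + 1) => ((z α / ((Lc ^ (k + 1) : ℕ) : ℤ) : ℤ) : ℝ))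
  beta_reduce at h
  rw [← h]
  refine tsum_congr fun x => ?_
  rw [Finset.sum_eq_single α]
  · rw [dz_coarseCoord hLc k α α x, if_pos rfl, one_mul]
  · intro κ _ hκ
    rw [dz_coarseCoord hLc k α κ x, if_neg hκ, zero_mul, zero_mul]
  · intro hα; exact absurd (Finset.mem_univ α) hα

/-- NOT IN PRINT; OUR BOOKKEEPING.  **THE SECOND FACE LEG KILLS EVERY TERM**: `[x′_β face] · Σ'_x [x_α face] · SΛ κ′ u x x′ (inl α) (inl β) = 0`
(`face_coordW_linKerAt_eq_zero` inside the `(μ, y)`-sums of `tsum_face_mul_SLam_hessFFAt`). -/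
theorem face_mul_tsum_face_mul_SLam_hessFFAt (hLc : 1 ≤ Lc) (hr : r ∈ box (d + 1) Lc)
    (c : Fin (d + 1) → (Fin (d + 1) → ℤ) → Fin (d + 1) → (Fin (d + 1) → ℤ) → ℝ) (κ' : Fin (d + 1)) (u x' : Site (d + 1)) (α β : Fin (d + 1)) (k : ℕ) :
    (if x' β % ((Lc ^ (k + 1) : ℕ) : ℤ) = ((Lc ^ (k + 1) : ℕ) : ℤ) - 1 then (1 : ℝ) else 0) *
      ∑' x : Site (d + 1), (if x α % ((Lc ^ (k + 1) : ℕ) : ℤ) = ((Lc ^ (k + 1) : ℕ) : ℤ) - 1 then (1 : ℝ) else 0) *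
        SLam Lc c (fun μ y => hessFFAt (toSite r) Lc μ y) κ' u x x' (Sum.inl α) (Sum.inl β) = 0 := by
  rw [tsum_face_mul_SLam_hessFFAt hLc hr c κ' u x' α β k, mul_neg, neg_eq_zero, Finset.mul_sum]
  refine Finset.sum_eq_zero fun μ _ => ?_
  rw [← tsum_mul_left]
  refine (tsum_congr fun y => ?_).trans tsum_zero
  have h0 := face_coordW_linKerAt_eq_zero hLc hr k μ y α β x'
  calc (if x' β % ((Lc ^ (k + 1) : ℕ) : ℤ) = ((Lc ^ (k + 1) : ℕ) : ℤ) - 1 then (1 : ℝ) else 0) * (c μ y κ' u *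
          (((((x') α / ((Lc ^ (k + 1) : ℕ) : ℤ) : ℤ) : ℝ) + (((x' + unitVec β) α / ((Lc ^ (k + 1) : ℕ) : ℤ) : ℤ) : ℝ) - ((((Lc : ℤ) • y + toSite r) α / ((Lc ^ (k + 1) : ℕ) : ℤ) : ℤ) : ℝ) - ((((Lc : ℤ) • y + toSite r + (Lc : ℤ) • unitVec μ) α / ((Lc ^ (k + 1) : ℕ) : ℤ) : ℤ) : ℝ)) * linKerAt (toSite r) Lc μ y (β, x') / 2))
      = c μ y κ' u / 2 * ((if x' β % ((Lc ^ (k + 1) : ℕ) : ℤ) = ((Lc ^ (k + 1) : ℕ) : ℤ) - 1 then (1 : ℝ) else 0) *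
          (((((x') α / ((Lc ^ (k + 1) : ℕ) : ℤ) : ℤ) : ℝ) + (((x' + unitVec β) α / ((Lc ^ (k + 1) : ℕ) : ℤ) : ℤ) : ℝ) - ((((Lc : ℤ) • y + toSite r) α / ((Lc ^ (k + 1) : ℕ) : ℤ) : ℤ) : ℝ) - ((((Lc : ℤ) • y + toSite r + (Lc : ℤ) • unitVec μ) α / ((Lc ^ (k + 1) : ℕ) : ℤ) : ℤ) : ℝ)) * linKerAt (toSite r) Lc μ y (β, x'))) := by ring
    _ = 0 := by rw [h0, mul_zero]

end Legs

/-! ## §4 The three-face-legs cell form of the Λ-piece vanishes (every slot; then summed over the slot face) -/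

section ThreeFace

variable {r : Fin (d + 1) → ℕ} [NeZero Lc]

/-- [folklore] a bounded two-leg weight keeps a bi-localised kernel's pair family summable. -/
theorem summable_weighted_pairs {K : MKer (d + 1) (Fib d)} {p q : Site (d + 1)} {C δ : ℝ} (hK : BiLoc K p q C δ) (hδ : 0 < δ)
    (a b : Fib d) (w : Site (d + 1) × Site (d + 1) → ℝ) (hw : ∀ yw, |w yw| ≤ 1) :
    Summable fun yw : Site (d + 1) × Site (d + 1) => w yw * K yw.1 yw.2 a b := by
  refine Summable.of_norm_bounded (KernelLegCharges.summable_prod_of_biLoc hK hδ a b).norm fun yw => ?_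
  rw [Real.norm_eq_abs, abs_mul, Real.norm_eq_abs]
  have h := hw yw
  nlinarith [abs_nonneg (K yw.1 yw.2 a b), abs_nonneg (w yw)]

/-- NOT IN PRINT; OUR BOOKKEEPING.  **THE TWO-FACE-LEGS PAIR SUM OF THE Λ-PIECE VANISHES AT EVERY SLOT** (any coefficient family `c` making the Λ-piece a local
stencil family; every exit-face period `Lc^{k+1}`). -/
theorem tsum_faces_SLam_hessFFAt_eq_zero (hLc : 1 ≤ Lc) (hr : r ∈ box (d + 1) Lc)
    {c : Fin (d + 1) → (Fin (d + 1) → ℤ) → Fin (d + 1) → (Fin (d + 1) → ℤ) → ℝ} {C δ : ℝ}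
    (hS : LocStencil (SLam Lc c (fun μ y => hessFFAt (toSite r) Lc μ y)) C δ) (hδ : 0 < δ)
    (κ' : Fin (d + 1)) (u : Site (d + 1)) (α β : Fin (d + 1)) (k : ℕ) :
    ∑' yw : Site (d + 1) × Site (d + 1),
        (if yw.1 α % ((Lc ^ (k + 1) : ℕ) : ℤ) = ((Lc ^ (k + 1) : ℕ) : ℤ) - 1 then (1 : ℝ) else 0) *
          (if yw.2 β % ((Lc ^ (k + 1) : ℕ) : ℤ) = ((Lc ^ (k + 1) : ℕ) : ℤ) - 1 then (1 : ℝ) else 0) *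
          SLam Lc c (fun μ y => hessFFAt (toSite r) Lc μ y) κ' u yw.1 yw.2 (Sum.inl α) (Sum.inl β) = 0 := by
  set SΛ := SLam Lc c (fun μ y => hessFFAt (toSite r) Lc μ y) with hSΛ
  set Fα : Site (d + 1) → ℝ := fun x => if x α % ((Lc ^ (k + 1) : ℕ) : ℤ) = ((Lc ^ (k + 1) : ℕ) : ℤ) - 1 then 1 else 0 with hFα
  set Fβ : Site (d + 1) → ℝ := fun x => if x β % ((Lc ^ (k + 1) : ℕ) : ℤ) = ((Lc ^ (k + 1) : ℕ) : ℤ) - 1 then 1 else 0 with hFβ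
  -- summability of the swapped pair family `(w, y) ↦ Fα y · Fβ w · SΛ y w`
  have hsw : Summable fun wy : Site (d + 1) × Site (d + 1) => Fα wy.2 * Fβ wy.1 * SΛ κ' u wy.2 wy.1 (Sum.inl α) (Sum.inl β) := by
    have h := summable_weighted_pairs (hS κ' u) hδ (Sum.inl α) (Sum.inl β) (fun yw => Fα yw.1 * Fβ yw.2) (fun yw => by
      show |Fα yw.1 * Fβ yw.2| ≤ 1
      simp only [hFα, hFβ]; split_ifs <;> simp)
    have e : (fun wy : Site (d + 1) × Site (d + 1) => Fα wy.2 * Fβ wy.1 * SΛ κ' u wy.2 wy.1 (Sum.inl α) (Sum.inl β))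
        = (fun yw : Site (d + 1) × Site (d + 1) => Fα yw.1 * Fβ yw.2 * SΛ κ' u yw.1 yw.2 (Sum.inl α) (Sum.inl β)) ∘ (Equiv.prodComm _ _) := by
      funext wy; rfl
    rw [e]
    exact (Equiv.summable_iff _).2 h
  -- swap the legs and sum the first leg innermost
  have hswap : (∑' yw : Site (d + 1) × Site (d + 1), Fα yw.1 * Fβ yw.2 * SΛ κ' u yw.1 yw.2 (Sum.inl α) (Sum.inl β))
      = ∑' wy : Site (d + 1) × Site (d + 1), Fα wy.2 * Fβ wy.1 * SΛ κ' u wy.2 wy.1 (Sum.inl α) (Sum.inl β) := by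
    rw [← (Equiv.prodComm (Site (d + 1)) (Site (d + 1))).tsum_eq]
    rfl
  have hgoal : (∑' yw : Site (d + 1) × Site (d + 1), Fα yw.1 * Fβ yw.2 * SΛ κ' u yw.1 yw.2 (Sum.inl α) (Sum.inl β)) = 0 := by
    rw [hswap, hsw.tsum_prod]
    refine (tsum_congr fun w => ?_).trans tsum_zero
    have e1 : (∑' y : Site (d + 1), Fα y * Fβ w * SΛ κ' u y w (Sum.inl α) (Sum.inl β))
        = Fβ w * ∑' y : Site (d + 1), Fα y * SΛ κ' u y w (Sum.inl α) (Sum.inl β) := by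
      rw [← tsum_mul_left]
      refine tsum_congr fun y => ?_
      ring
    rw [e1]
    exact face_mul_tsum_face_mul_SLam_hessFFAt hLc hr c κ' u w α β k
  simpa only [hFα, hFβ, hSΛ] using hgoal

/-- NOT IN PRINT; OUR BOOKKEEPING.  **THE THREE-FACE-LEGS CELL FORM OF THE Λ-PIECE VANISHES** (every slot face, every period `Lc^{k+1}`, any admissible `c`). -/
theorem threeFace_SLam_hessFFAt_eq_zero (hLc : 1 ≤ Lc) (hr : r ∈ box (d + 1) Lc)
    {c : Fin (d + 1) → (Fin (d + 1) → ℤ) → Fin (d + 1) → (Fin (d + 1) → ℤ) → ℝ} {C δ : ℝ}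
    (hS : LocStencil (SLam Lc c (fun μ y => hessFFAt (toSite r) Lc μ y)) C δ) (hδ : 0 < δ)
    (k : ℕ) (γ α β : Fin (d + 1)) :
    ∑ v ∈ box (d + 1) (Lc ^ (k + 1)), (if toSite v γ % ((Lc ^ (k + 1) : ℕ) : ℤ) = ((Lc ^ (k + 1) : ℕ) : ℤ) - 1 then (1 : ℝ) else 0) *
        ∑' yw : Site (d + 1) × Site (d + 1),
          (if yw.1 α % ((Lc ^ (k + 1) : ℕ) : ℤ) = ((Lc ^ (k + 1) : ℕ) : ℤ) - 1 then (1 : ℝ) else 0) *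
            (if yw.2 β % ((Lc ^ (k + 1) : ℕ) : ℤ) = ((Lc ^ (k + 1) : ℕ) : ℤ) - 1 then (1 : ℝ) else 0) *
            SLam Lc c (fun μ y => hessFFAt (toSite r) Lc μ y) γ (toSite v) yw.1 yw.2 (Sum.inl α) (Sum.inl β) = 0 := by
  refine Finset.sum_eq_zero fun v _ => ?_
  rw [tsum_faces_SLam_hessFFAt_eq_zero hLc hr hS hδ γ (toSite v) α β k, mul_zero]

end ThreeFace


/-! ## §5 Bałaban's coefficient families: the Λ-pieces of the recursive step family (every level) and of the level-0 table -/

section Balaban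

variable {r : Fin (d + 1) → ℕ} [NeZero Lc]

/-- NOT IN PRINT; OUR BOOKKEEPING.  **(T-H)_face AT EVERY LEVEL `j+1`** — the hypothesis `hΛ` of `ThreeFaceRecOfLetters.threeFace_rec_of_letters`, DISCHARGED:
the three-face-legs cell form (period `Lc^{k+1}`) of the Λ-piece `SLam Lc (lamCoeffK (KInvStep Lc (j+1)) (E2 d Lc (j+1)) Lc) hessFFAt` of
`WardLocusRecursive.SrecAt … (j+1)` vanishes (its local-stencil property as in `WardLocusRecursive.locStencil_SrecAt`). -/
theorem threeFace_SLam_lamCoeffK_eq_zero (hLc : 1 ≤ Lc) (hr : r ∈ box (d + 1) Lc) (j k : ℕ) (γ α β : Fin (d + 1)) :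
    ∑ v ∈ box (d + 1) (Lc ^ (k + 1)), (if toSite v γ % ((Lc ^ (k + 1) : ℕ) : ℤ) = ((Lc ^ (k + 1) : ℕ) : ℤ) - 1 then (1 : ℝ) else 0) *
        ∑' yw : Site (d + 1) × Site (d + 1),
          (if yw.1 α % ((Lc ^ (k + 1) : ℕ) : ℤ) = ((Lc ^ (k + 1) : ℕ) : ℤ) - 1 then (1 : ℝ) else 0) *
            (if yw.2 β % ((Lc ^ (k + 1) : ℕ) : ℤ) = ((Lc ^ (k + 1) : ℕ) : ℤ) - 1 then (1 : ℝ) else 0) *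
            SLam Lc (lamCoeffK (KInvStep (d := d) Lc (j + 1)) (E2 d Lc (j + 1)) Lc) (fun μ y => hessFFAt (toSite r) Lc μ y)
              γ (toSite v) yw.1 yw.2 (Sum.inl α) (Sum.inl β) = 0 := by
  obtain ⟨δA, CA, hδA, hCA, hA⟩ := decays_KInvStep (Lc := Lc) (d := d) (j + 1)
  obtain ⟨δE, CE, hδE, hCE, hE⟩ := decays_E2 (d := d) (Lc := Lc) (j + 1)
  set n : ℝ := min δA δE with hn
  have hn0 : 0 < n := lt_min hδA hδE
  have hA' : Decays (KInvStep (d := d) Lc (j + 1)) CA n := decays_mono hA hCA le_rfl (min_le_left _ _)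
  have hE' : Decays (E2 d Lc (j + 1)) CE n := decays_mono hE hCE le_rfl (min_le_right _ _)
  have hc := abs_lamCoeffK_le hA' hE' hn0 Lc
  have hn2 : (0 : ℝ) ≤ n / 2 := by positivity
  have hQ : VertexFamily (fun μ y => hessFFAt (toSite r) Lc μ y) Lc
      (2 * (ell (d + 1) Lc : ℝ) ^ 2 * Real.exp (4 * ((d : ℝ) + 1) * Lc * (n / 2))) (n / 2) :=
    fun μ y => biLoc_hessFFAt hLc μ y hr hn2
  have h3 := locStencil_SLam (N := Lc) hc hQ (by positivity)
    (mul_nonneg (mul_nonneg (Nat.cast_nonneg _) (mul_nonneg hCA hCE)) (Zl_nonneg (by linarith)))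
  exact threeFace_SLam_hessFFAt_eq_zero hLc hr h3 (by positivity) k γ α β

/-- NOT IN PRINT; OUR BOOKKEEPING.  **(T-H)_face AT LEVEL 0** — the Λ₀ part of the hypothesis `h0` of `threeFace_rec_of_letters`: the three-face-legs cell form of the
Λ-piece `SLam Lc (lamCoeffOf (KInv Lc) Lc) hessFFAt` of `SpineRootedS0N.S0NAt` vanishes. -/
theorem threeFace_SLam_lamCoeffOf_eq_zero (hLc : 1 ≤ Lc) (hr : r ∈ box (d + 1) Lc) (k : ℕ) (γ α β : Fin (d + 1)) :
    ∑ v ∈ box (d + 1) (Lc ^ (k + 1)), (if toSite v γ % ((Lc ^ (k + 1) : ℕ) : ℤ) = ((Lc ^ (k + 1) : ℕ) : ℤ) - 1 then (1 : ℝ) else 0) *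
        ∑' yw : Site (d + 1) × Site (d + 1),
          (if yw.1 α % ((Lc ^ (k + 1) : ℕ) : ℤ) = ((Lc ^ (k + 1) : ℕ) : ℤ) - 1 then (1 : ℝ) else 0) *
            (if yw.2 β % ((Lc ^ (k + 1) : ℕ) : ℤ) = ((Lc ^ (k + 1) : ℕ) : ℤ) - 1 then (1 : ℝ) else 0) *
            SLam Lc (lamCoeffOf (KInv (N := Lc) (d := d)) Lc) (fun μ y => hessFFAt (toSite r) Lc μ y)
              γ (toSite v) yw.1 yw.2 (Sum.inl α) (Sum.inl β) = 0 := by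
  obtain ⟨δ₀, C, hδ₀, hC, hdec⟩ := decays_KInv (N := Lc) (d := d)
  have hc := abs_lamCoeffOf_le (N := Lc) hdec hC hδ₀.le
  have hQ : VertexFamily (fun μ y => hessFFAt (toSite r) Lc μ y) Lc
      (2 * (ell (d + 1) Lc : ℝ) ^ 2 * Real.exp (4 * ((d : ℝ) + 1) * Lc * δ₀)) δ₀ :=
    fun μ y => biLoc_hessFFAt hLc μ y hr hδ₀.le
  have h3 := locStencil_SLam (N := Lc) hc hQ hδ₀ (mul_nonneg (mul_nonneg (by positivity) hC) (Real.exp_pos _).le)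
  exact threeFace_SLam_hessFFAt_eq_zero hLc hr h3 (by positivity) k γ α β

end Balaban

end Summit.QuantumFields.BalabanUV.Beta.GAN24.LambdaPieceThreeFace

end
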